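import Literature.Geometry.DiscreteGeometry.KissingPatterns
import Summits.Ventures.Crystal3D.Theorems.StickyWulffConstantGenericWallFloorExactOnly
import Summits.Ventures.Crystal3D.Theorems.StickyWulffConstantGenericWallFloorCubicCoords
import HarnessLib

/-!
# No cavity next to a close-packed dozen: the Voronoi cell of either Barlow dozen has circumradius `1/√2`
# (input (G0a) of the terrace census, memo CENSUS-AUDIT-g18 §4; 19480-p1 g18)

HONEST FRAMING. Venture `Summits/Ventures/Crystal3D` (cell `crystal3d-full`), route `route-Ventures-StickyWulffConstant`,
helper `--supports` the law-v5 crux `TextureLiminfV5` (stmt-Ventures-23912), lane T, line `TexShadow`, mechanism (β)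
(terrace census, `…TexShadowTerraceCensusDefs`).  Pure Euclidean geometry of the two kissing dozens; NOTHING about
ground states; F-C1 not moved.

THE POINT (memo CENSUS-AUDIT-g18 §1/§4, input (G0a) «no cavity»).  In the exact-contact model a ball with twelve
contacts carries an fcc or an hcp dozen (`L12Local`).  The VORONOI CELL of the centre relative to its dozen — the
rhombic dodecahedron (fcc) resp. the trapezo-rhombic dodecahedron (hcp) — has circumradius exactly `1/√2` (the
octahedral holes).  Hence: **a point whose nearest centre is a twelve-fold ball lies within `1/√2` of it**; equivalently a
point farther than `1/√2` from every centre has an UNSATURATED nearest centre.  This is the pointwise half of the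
no-channel input of the census (the tube form with the sharp radius `1/√3` is a separate statement).

* `sq_add_sq_add_sq_le_of_abs_add_abs_le` — the algebra: `|a|+|b|, |a|+|c|, |b|+|c| ≤ k ⇒ a²+b²+c² ≤ k²` (the
  rhombic dodecahedron `{|xᵢ|+|xⱼ| ≤ k}` lies in the ball of radius `k`; equality at its six 4-valent vertices).
* `fccModel_sq_le_one` / `hcpModel_sq_le_one` — integer models: `⟨u, v⟩ ≤ 1 ∀ v ∈ fccInt ⇒ |u|² ≤ 1`, and
  `⟨u, v⟩ ≤ 3 ∀ v ∈ hcpInt ⇒ |u|² ≤ 1` (the hcp cell is reduced to the fcc one: its half `x+y+z ≥ 0` lies in the fcc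
  cell, its half `x+y+z ≤ 0` in the mirror-image fcc cell).
* `norm_sq_le_half_of_inner_fccKissingPattern_le` / `…hcpKissingPattern…` (+ `_map` versions through a linear
  isometry) — `⟪x, p⟫ ≤ ½` for the twelve pattern vectors `p` ⇒ `‖x‖² ≤ ½`.
* **`dist_sq_le_half_of_isClosePackedDozenAt`** — if `D` is a close-packed dozen around `c` and `y` is at least as
  close to `c` as to every ball of `D`, then `dist y c ² ≤ ½`.
* **`two_le_dist_sq_of_isClosePackedDozenAt`** (SECOND-SHELL GAP) — a point `z ≠ c` at distance `≥ 1` from the twelve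
  balls of a close-packed dozen around `c` has `dist z c ² ≥ 2`: no thirteenth centre closer than `√2`.  (The same
  inequality applied to `(z − c)/‖z − c‖²`.)
* **`dist_le_dist_of_isClosePackedDozenAt`** — consequently the Voronoi cell of a twelve-fold ball in ANY `1`-separated
  configuration is its dozen's cell: no other centre's bisector cuts in; so the nearest saturated centres along a curve
  form a chain of CONTACT neighbours (the census's rigidity propagation along good columns needs no tube radius).
* `norm_sq_le_half_of_inner_fccSlots_le` — the same for the lattice's twelve slots `fccSlots` (via `cubicCoords`).
WHAT THIS IS NOT: the tube/no-channel statement with a lateral radius (`1/√3`, CENSUS-AUDIT-g18 §1) — superseded for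
the census by the Voronoi form above; anything about energies.
-/

noncomputable section

namespace Summit.Ventures.Crystal3D.Theorems

open Finset Literature.Geometry.DiscreteGeometry NearIdentity
open scoped RealInnerProductSpace

/-! ## The algebra of the rhombic dodecahedron -/

/-- **The rhombic dodecahedron `{|xᵢ| + |xⱼ| ≤ k}` lies in the ball of radius `k`:**
`|a|+|b| ≤ k`, `|a|+|c| ≤ k`, `|b|+|c| ≤ k` imply `a² + b² + c² ≤ k²` (equality at `(±k, 0, 0)` and permutations). -/
theorem sq_add_sq_add_sq_le_of_abs_add_abs_le {k a b c : ℝ} (hab : |a| + |b| ≤ k) (hac : |a| + |c| ≤ k)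
    (hbc : |b| + |c| ≤ k) : a ^ 2 + b ^ 2 + c ^ 2 ≤ k ^ 2 := by
  have ha := abs_nonneg a; have hb := abs_nonneg b; have hc := abs_nonneg c
  have h1 : |a| * |a| ≤ |a| * (k - |b|) := mul_le_mul_of_nonneg_left (by linarith) ha
  have h2 : |b| * |b| ≤ |b| * (k - |c|) := mul_le_mul_of_nonneg_left (by linarith) hb
  have h3 : |c| * |c| ≤ |c| * (k - |a|) := mul_le_mul_of_nonneg_left (by linarith) hc
  have h4 : 0 ≤ (k - |a| - |b|) * (k - |c|) := mul_nonneg (by linarith) (by linarith)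
  have e : a ^ 2 + b ^ 2 + c ^ 2 = |a| * |a| + |b| * |b| + |c| * |c| := by
    rw [← sq_abs a, ← sq_abs b, ← sq_abs c]; ring
  rw [e]
  nlinarith [mul_nonneg ha hb]

/-- Four sign combinations `±a ± b ≤ k` give `|a| + |b| ≤ k`. -/
theorem abs_add_abs_le_of_signs {k a b : ℝ} (h₁ : a + b ≤ k) (h₂ : a - b ≤ k) (h₃ : -a + b ≤ k)
    (h₄ : -a - b ≤ k) : |a| + |b| ≤ k := by
  rcases abs_cases a with ⟨ha, -⟩ | ⟨ha, -⟩ <;> rcases abs_cases b with ⟨hb, -⟩ | ⟨hb, -⟩ <;>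
    rw [ha, hb] <;> linarith

/-! ## Integer models of the two dozens -/

/-- **fcc model.**  If `a v₀ + b v₁ + c v₂ ≤ 1` for the twelve vectors `v ∈ fccInt` (all `(±1, ±1, 0)` and
permutations), then `a² + b² + c² ≤ 1`: the Voronoi cell of the cuboctahedral dozen, scaled to `{|xᵢ|+|xⱼ| ≤ 1}`,
has circumradius `1`. -/
theorem fccModel_sq_le_one (a b c : ℝ) (h : ∀ v ∈ fccInt, a * v 0 + b * v 1 + c * v 2 ≤ 1) :
    a ^ 2 + b ^ 2 + c ^ 2 ≤ 1 := by
  have k : ∀ v ∈ fccInt, a * v 0 + b * v 1 + c * v 2 ≤ 1 := h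
  simp only [fccInt, mem_insert, mem_singleton, forall_eq_or_imp, forall_eq] at k
  simp only [Matrix.cons_val_zero, Matrix.cons_val_one, Matrix.cons_val_two, Matrix.head_cons, Matrix.tail_cons,
    Int.cast_one, Int.cast_zero, Int.cast_neg, mul_one, mul_zero, mul_neg, add_zero, zero_add] at k
  obtain ⟨k1, k2, k3, k4, k5, k6, k7, k8, k9, k10, k11, k12⟩ := k
  have hab : |a| + |b| ≤ 1 := abs_add_abs_le_of_signs (by linarith) (by linarith) (by linarith) (by linarith)
  have hac : |a| + |c| ≤ 1 := abs_add_abs_le_of_signs (by linarith) (by linarith) (by linarith) (by linarith)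
  have hbc : |b| + |c| ≤ 1 := abs_add_abs_le_of_signs (by linarith) (by linarith) (by linarith) (by linarith)
  have := sq_add_sq_add_sq_le_of_abs_add_abs_le hab hac hbc
  linarith

/-- **hcp model.**  If `a v₀ + b v₁ + c v₂ ≤ 3` for the twelve vectors `v ∈ hcpInt` (the anticuboctahedral dozen
scaled by `3`: hexagon `3(eᵢ − eⱼ)`, upper cap `3(eᵢ + eⱼ)`, lower cap its mirror image in the plane `x+y+z = 0`), then
`a² + b² + c² ≤ 1`: the trapezo-rhombic dodecahedron has circumradius `1` as well.  Proof: the half `a+b+c ≥ 0` of the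
cell lies in the fcc cell, the half `a+b+c ≤ 0` in its mirror image `x ↦ x − (2/3)(x+y+z)(1,1,1)` (an isometry). -/
theorem hcpModel_sq_le_one (a b c : ℝ) (h : ∀ v ∈ hcpInt, a * v 0 + b * v 1 + c * v 2 ≤ 3) :
    a ^ 2 + b ^ 2 + c ^ 2 ≤ 1 := by
  have k : ∀ v ∈ hcpInt, a * v 0 + b * v 1 + c * v 2 ≤ 3 := h
  simp only [hcpInt, mem_insert, mem_singleton, forall_eq_or_imp, forall_eq] at k
  simp only [Matrix.cons_val_zero, Matrix.cons_val_one, Matrix.cons_val_two, Matrix.head_cons, Matrix.tail_cons,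
    Int.cast_ofNat, Int.cast_zero, Int.cast_neg, Int.cast_one, mul_zero, mul_neg, add_zero, zero_add, mul_one] at k
  obtain ⟨k1, k2, k3, k4, k5, k6, k7, k8, k9, k10, k11, k12⟩ := k
  -- hexagon: |a-b|, |a-c|, |b-c| ≤ 1; upper cap: a+b, a+c, b+c ≤ 1; lower cap: a+b+4c, a+4b+c, 4a+b+c ≥ -3
  rcases le_total 0 (a + b + c) with hs | hs
  · -- upper half: inside the fcc cell
    refine fccModel_sq_le_one a b c ?_
    intro v hv
    simp only [fccInt, mem_insert, mem_singleton] at hv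
    rcases hv with rfl | rfl | rfl | rfl | rfl | rfl | rfl | rfl | rfl | rfl | rfl | rfl <;>
      simp <;> linarith
  · -- lower half: the mirror image `x' = x - (2/3) s` lies in the fcc cell and has the same norm
    set s := a + b + c with hs_def
    have e : a ^ 2 + b ^ 2 + c ^ 2 = (a - 2 / 3 * s) ^ 2 + (b - 2 / 3 * s) ^ 2 + (c - 2 / 3 * s) ^ 2 := by
      rw [hs_def]; ring
    rw [e]
    refine fccModel_sq_le_one _ _ _ ?_
    intro v hv
    simp only [fccInt, mem_insert, mem_singleton] at hv
    rcases hv with rfl | rfl | rfl | rfl | rfl | rfl | rfl | rfl | rfl | rfl | rfl | rfl <;>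
      simp <;> linarith

/-! ## The two kissing patterns in `ℝ³` -/

/-- The inner product with an integer vector, in coordinates. -/
private theorem inner_intVec (x : EuclideanSpace ℝ (Fin 3)) (v : Fin 3 → ℤ) :
    ⟪x, intVec v⟫ = x 0 * v 0 + x 1 * v 1 + x 2 * v 2 := by
  simp [intVec, PiLp.inner_apply, Fin.sum_univ_three, mul_comm]

/-- `‖x‖²` in coordinates. -/
private theorem norm_sq_coords (x : EuclideanSpace ℝ (Fin 3)) : ‖x‖ ^ 2 = x 0 ^ 2 + x 1 ^ 2 + x 2 ^ 2 := by
  rw [EuclideanSpace.norm_eq, Real.sq_sqrt (Finset.sum_nonneg fun i _ => sq_nonneg _), Fin.sum_univ_three]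
  simp only [Real.norm_eq_abs, sq_abs]

/-- **Circumradius of the rhombic dodecahedron**: if `⟪x, p⟫ ≤ ½` for the twelve vectors `p` of the fcc kissing pattern
(i.e. `x` is at least as close to the centre as to each of its twelve neighbours), then `‖x‖² ≤ ½`. -/
theorem norm_sq_le_half_of_inner_fccKissingPattern_le (x : EuclideanSpace ℝ (Fin 3))
    (h : ∀ p ∈ fccKissingPattern, ⟪x, p⟫ ≤ 1 / 2) : ‖x‖ ^ 2 ≤ 1 / 2 := by
  have hs0 : 0 < Real.sqrt 2 := by positivity
  have hs2 : Real.sqrt 2 ^ 2 = 2 := Real.sq_sqrt (by norm_num)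
  have hm := fccModel_sq_le_one (Real.sqrt 2 * x 0) (Real.sqrt 2 * x 1) (Real.sqrt 2 * x 2) (fun v hv => by
    have hp : (Real.sqrt 2)⁻¹ • intVec v ∈ fccKissingPattern := Finset.mem_image_of_mem _ hv
    have h1 := h _ hp
    rw [real_inner_smul_right, inner_intVec] at h1
    have h2 := mul_le_mul_of_nonneg_left h1 hs0.le
    rw [← mul_assoc, mul_inv_cancel₀ hs0.ne', one_mul] at h2
    have h4 := mul_le_mul_of_nonneg_left h2 hs0.le
    have h5 : Real.sqrt 2 * (Real.sqrt 2 * (1 / 2)) = 1 := by nlinarith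
    rw [h5] at h4
    linarith)
  rw [norm_sq_coords]
  nlinarith

/-- **Circumradius of the trapezo-rhombic dodecahedron**: if `⟪x, p⟫ ≤ ½` for the twelve vectors `p` of the hcp kissing
pattern, then `‖x‖² ≤ ½`. -/
theorem norm_sq_le_half_of_inner_hcpKissingPattern_le (x : EuclideanSpace ℝ (Fin 3))
    (h : ∀ p ∈ hcpKissingPattern, ⟪x, p⟫ ≤ 1 / 2) : ‖x‖ ^ 2 ≤ 1 / 2 := by
  have hs0 : 0 < Real.sqrt 2 := by positivity
  have hs2 : Real.sqrt 2 ^ 2 = 2 := Real.sq_sqrt (by norm_num)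
  have h18 : Real.sqrt (18 : ℕ) = 3 * Real.sqrt 2 := by
    rw [show ((18 : ℕ) : ℝ) = 3 ^ 2 * 2 by norm_num, Real.sqrt_mul (by norm_num), Real.sqrt_sq (by norm_num)]
  have hm := hcpModel_sq_le_one (Real.sqrt 2 * x 0) (Real.sqrt 2 * x 1) (Real.sqrt 2 * x 2) (fun v hv => by
    have hp : (Real.sqrt (18 : ℕ))⁻¹ • intVec v ∈ hcpKissingPattern := Finset.mem_image_of_mem _ hv
    have h1 := h _ hp
    rw [real_inner_smul_right, inner_intVec, h18] at h1
    have h30 : (0 : ℝ) < 3 * Real.sqrt 2 := by positivity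
    have h2 := mul_le_mul_of_nonneg_left h1 h30.le
    rw [← mul_assoc, mul_inv_cancel₀ h30.ne', one_mul] at h2
    have h4 := mul_le_mul_of_nonneg_left h2 hs0.le
    have h5 : Real.sqrt 2 * (3 * Real.sqrt 2 * (1 / 2)) = 3 := by nlinarith
    rw [h5] at h4
    linarith)
  rw [norm_sq_coords]
  nlinarith

/-- fcc, through a linear isometry `A` (any orientation of the dozen). -/
theorem norm_sq_le_half_of_inner_map_fccKissingPattern_le
    (A : EuclideanSpace ℝ (Fin 3) →ₗᵢ[ℝ] EuclideanSpace ℝ (Fin 3)) (x : EuclideanSpace ℝ (Fin 3))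
    (h : ∀ p ∈ fccKissingPattern, ⟪x, A p⟫ ≤ 1 / 2) : ‖x‖ ^ 2 ≤ 1 / 2 := by
  let A' : EuclideanSpace ℝ (Fin 3) ≃ₗᵢ[ℝ] EuclideanSpace ℝ (Fin 3) := A.toLinearIsometryEquiv rfl
  have hA' : ∀ p, A' p = A p := fun p => rfl
  have := norm_sq_le_half_of_inner_fccKissingPattern_le (A'.symm x) (fun p hp => by
    rw [← A'.inner_map_map, A'.apply_symm_apply, hA']; exact h p hp)
  rwa [LinearIsometryEquiv.norm_map] at this

/-- hcp, through a linear isometry `A` (any orientation of the dozen). -/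
theorem norm_sq_le_half_of_inner_map_hcpKissingPattern_le
    (A : EuclideanSpace ℝ (Fin 3) →ₗᵢ[ℝ] EuclideanSpace ℝ (Fin 3)) (x : EuclideanSpace ℝ (Fin 3))
    (h : ∀ p ∈ hcpKissingPattern, ⟪x, A p⟫ ≤ 1 / 2) : ‖x‖ ^ 2 ≤ 1 / 2 := by
  let A' : EuclideanSpace ℝ (Fin 3) ≃ₗᵢ[ℝ] EuclideanSpace ℝ (Fin 3) := A.toLinearIsometryEquiv rfl
  have hA' : ∀ p, A' p = A p := fun p => rfl
  have := norm_sq_le_half_of_inner_hcpKissingPattern_le (A'.symm x) (fun p hp => by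
    rw [← A'.inner_map_map, A'.apply_symm_apply, hA']; exact h p hp)
  rwa [LinearIsometryEquiv.norm_map] at this

/-! ## No cavity next to a close-packed dozen -/

/-- If `y` is at least as close to `c` as to `c + q` with `‖q‖ = 1`, then `⟪y − c, q⟫ ≤ ½`. -/
theorem inner_le_half_of_dist_le {y c q : EuclideanSpace ℝ (Fin 3)} (hq : ‖q‖ = 1)
    (h : dist y c ≤ dist y (q + c)) : ⟪y - c, q⟫ ≤ 1 / 2 := by
  have h1 : ‖y - c‖ ^ 2 ≤ ‖(y - c) - q‖ ^ 2 := by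
    rw [dist_eq_norm, dist_eq_norm, show y - (q + c) = (y - c) - q by abel] at h
    exact pow_le_pow_left₀ (norm_nonneg _) h 2
  rw [norm_sub_sq_real (y - c) q, hq] at h1
  linarith

/-- **NO CAVITY NEXT TO A CLOSE-PACKED DOZEN.**  If `D` is a close-packed (fcc or hcp) dozen around `c` and the point `y`
is at least as close to `c` as to every ball of `D` — in particular if `c` is a centre nearest to `y` in a configuration
containing `D` — then `dist y c ≤ 1/√2`, i.e. `dist y c ² ≤ ½`: the circumradius of either Voronoi cell.  Contrapositive
(with `L12Local`): a point farther than `1/√2` from all centres of a unit packing has an unsaturated nearest centre. -/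
theorem dist_sq_le_half_of_isClosePackedDozenAt {c : EuclideanSpace ℝ (Fin 3)}
    {D : Finset (EuclideanSpace ℝ (Fin 3))} (hD : IsClosePackedDozenAt c D) (y : EuclideanSpace ℝ (Fin 3))
    (hy : ∀ d ∈ D, dist y c ≤ dist y d) : dist y c ^ 2 ≤ 1 / 2 := by
  obtain ⟨A, hA | hA⟩ := hD
  · rw [dist_eq_norm]
    refine norm_sq_le_half_of_inner_map_fccKissingPattern_le A (y - c) (fun p hp => ?_)
    have hmem : A p + c ∈ D := by
      rw [← Finset.mem_coe, hA]; exact ⟨p, Finset.mem_coe.2 hp, rfl⟩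
    refine inner_le_half_of_dist_le ?_ (hy _ hmem)
    rw [A.norm_map]; exact norm_eq_one_of_mem_scaledPattern two_ne_zero sqNormInt_fccInt hp
  · rw [dist_eq_norm]
    refine norm_sq_le_half_of_inner_map_hcpKissingPattern_le A (y - c) (fun p hp => ?_)
    have hmem : A p + c ∈ D := by
      rw [← Finset.mem_coe, hA]; exact ⟨p, Finset.mem_coe.2 hp, rfl⟩
    refine inner_le_half_of_dist_le ?_ (hy _ hmem)
    rw [A.norm_map]; exact norm_eq_one_of_mem_scaledPattern (by norm_num) sqNormInt_hcpInt hp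

/-- The same with the conclusion as a distance: `dist y c ≤ √2 / 2 (= 1/√2 ≈ 0.7071)`. -/
theorem dist_le_of_isClosePackedDozenAt {c : EuclideanSpace ℝ (Fin 3)}
    {D : Finset (EuclideanSpace ℝ (Fin 3))} (hD : IsClosePackedDozenAt c D) (y : EuclideanSpace ℝ (Fin 3))
    (hy : ∀ d ∈ D, dist y c ≤ dist y d) : dist y c ≤ Real.sqrt 2 / 2 := by
  have h := dist_sq_le_half_of_isClosePackedDozenAt hD y hy
  have hs : (Real.sqrt 2 / 2) ^ 2 = 1 / 2 := by
    rw [div_pow, Real.sq_sqrt (by norm_num)]; norm_num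
  exact (pow_le_pow_iff_left₀ dist_nonneg (by positivity) two_ne_zero).1 (by rw [hs]; exact h)

/-! ## The second-shell gap and the Voronoi cell in a packing -/

/-- **SECOND-SHELL GAP.**  If `D` is a close-packed dozen around `c` and `z ≠ c` keeps distance `≥ 1` from all twelve
balls of `D`, then `dist z c ² ≥ 2`: no thirteenth centre comes closer than `√2` (the octahedral sites) to a twelve-fold
ball.  (Apply the circumradius bound to `x = (z − c)/‖z − c‖²`: the twelve constraints `‖z − d‖ ≥ 1` read
`⟪z − c, d − c⟫ ≤ ‖z − c‖²/2`.) -/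
theorem two_le_dist_sq_of_isClosePackedDozenAt {c : EuclideanSpace ℝ (Fin 3)}
    {D : Finset (EuclideanSpace ℝ (Fin 3))} (hD : IsClosePackedDozenAt c D) {z : EuclideanSpace ℝ (Fin 3)}
    (hzc : z ≠ c) (hz : ∀ d ∈ D, 1 ≤ dist z d) : 2 ≤ dist z c ^ 2 := by
  have hρ : 0 < dist z c := dist_pos.2 hzc
  set ρ2 : ℝ := dist z c ^ 2 with hρ2
  have hρ2pos : 0 < ρ2 := by positivity
  -- the twelve constraints
  have key : ∀ q : EuclideanSpace ℝ (Fin 3), ‖q‖ = 1 → 1 ≤ dist z (q + c) → ⟪ρ2⁻¹ • (z - c), q⟫ ≤ 1 / 2 := by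
    intro q hq h1
    have h2 : 1 ≤ ‖(z - c) - q‖ ^ 2 := by
      rw [dist_eq_norm, show z - (q + c) = (z - c) - q by abel] at h1
      nlinarith [norm_nonneg ((z - c) - q)]
    rw [norm_sub_sq_real (z - c) q, hq, ← dist_eq_norm] at h2
    rw [real_inner_smul_left]
    have h3 : ⟪z - c, q⟫ ≤ ρ2 / 2 := by rw [hρ2]; linarith
    calc ρ2⁻¹ * ⟪z - c, q⟫ ≤ ρ2⁻¹ * (ρ2 / 2) := mul_le_mul_of_nonneg_left h3 (inv_nonneg.2 hρ2pos.le)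
      _ = 1 / 2 := by field_simp
  have hx : ‖ρ2⁻¹ • (z - c)‖ ^ 2 ≤ 1 / 2 := by
    obtain ⟨A, hA | hA⟩ := hD
    · refine norm_sq_le_half_of_inner_map_fccKissingPattern_le A _ (fun p hp => key _ ?_ (hz _ ?_))
      · rw [A.norm_map]; exact norm_eq_one_of_mem_scaledPattern two_ne_zero sqNormInt_fccInt hp
      · rw [← Finset.mem_coe, hA]; exact ⟨p, Finset.mem_coe.2 hp, rfl⟩
    · refine norm_sq_le_half_of_inner_map_hcpKissingPattern_le A _ (fun p hp => key _ ?_ (hz _ ?_))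
      · rw [A.norm_map]; exact norm_eq_one_of_mem_scaledPattern (by norm_num) sqNormInt_hcpInt hp
      · rw [← Finset.mem_coe, hA]; exact ⟨p, Finset.mem_coe.2 hp, rfl⟩
  rw [norm_smul, mul_pow, Real.norm_of_nonneg (inv_nonneg.2 hρ2pos.le), ← dist_eq_norm, ← hρ2, inv_pow] at hx
  -- `ρ2⁻² · ρ2 ≤ 1/2`, i.e. `ρ2⁻¹ ≤ 1/2`
  have h4 : (ρ2 ^ 2)⁻¹ * ρ2 = ρ2⁻¹ := by field_simp
  rw [h4] at hx
  have h5 := mul_le_mul_of_nonneg_left hx hρ2pos.le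
  rw [mul_inv_cancel₀ hρ2pos.ne'] at h5
  linarith

/-- **THE VORONOI CELL OF A TWELVE-FOLD BALL IN A PACKING IS ITS DOZEN'S CELL.**  If `D` is a close-packed dozen around
`c`, `y` is at least as close to `c` as to every ball of `D`, and `z ≠ c` is any point keeping distance `≥ 1` from the
balls of `D` (e.g. any other centre of a `1`-separated configuration containing `D`), then `y` is at least as close to
`c` as to `z`.  Hence along any curve the nearest saturated centres form a chain of CONTACT neighbours — the form in
which the census propagates rigidity along good columns (no tube radius, no channel). -/
theorem dist_le_dist_of_isClosePackedDozenAt {c : EuclideanSpace ℝ (Fin 3)}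
    {D : Finset (EuclideanSpace ℝ (Fin 3))} (hD : IsClosePackedDozenAt c D) {y z : EuclideanSpace ℝ (Fin 3)}
    (hy : ∀ d ∈ D, dist y c ≤ dist y d) (hzc : z ≠ c) (hz : ∀ d ∈ D, 1 ≤ dist z d) : dist y c ≤ dist y z := by
  have h1 : dist y c ≤ Real.sqrt 2 / 2 := dist_le_of_isClosePackedDozenAt hD y hy
  have h2 : 2 ≤ dist z c ^ 2 := two_le_dist_sq_of_isClosePackedDozenAt hD hzc hz
  have hs : Real.sqrt 2 ^ 2 = 2 := Real.sq_sqrt (by norm_num)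
  have h3 : Real.sqrt 2 ≤ dist z c := by
    refine (pow_le_pow_iff_left₀ (by positivity) dist_nonneg two_ne_zero).1 ?_
    rw [hs]; exact h2
  have h4 : dist z c ≤ dist z y + dist y c := dist_triangle z y c
  rw [dist_comm z y] at h4
  linarith

/-! ## The lattice's own slots -/

/-- **The same for the twelve slots of `Λ₀`**: `⟪x, w⟫ ≤ ½` for all `w ∈ fccSlots` ⇒ `‖x‖² ≤ ½` (via the orthonormal
cubic coordinates, in which the slots are `(±1, ±1, 0)/√2` and permutations). -/
theorem norm_sq_le_half_of_inner_fccSlots_le (x : EuclideanSpace ℝ (Fin 3))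
    (h : ∀ w ∈ fccSlots, ⟪x, w⟫ ≤ 1 / 2) : ‖x‖ ^ 2 ≤ 1 / 2 := by
  have hs0 : 0 < Real.sqrt 2 := by positivity
  have hs2 : Real.sqrt 2 ^ 2 = 2 := Real.sq_sqrt (by norm_num)
  have hk : ∀ k : Fin 12, cubicCoords x 0 * slotInt k 0 + cubicCoords x 1 * slotInt k 1 + cubicCoords x 2 * slotInt k 2
      ≤ Real.sqrt 2 / 2 := by
    intro k
    have h1 := h (slotSite k) (slotSite_mem k)
    rw [inner_eq_cubicCoords, cubicCoords_slotSite] at h1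
    simp only [dotProduct, Fin.sum_univ_three, slotVec] at h1
    have h2 := mul_le_mul_of_nonneg_left h1 hs0.le
    have e : Real.sqrt 2 * (cubicCoords x 0 * ((slotInt k 0 : ℝ) / Real.sqrt 2) +
        cubicCoords x 1 * ((slotInt k 1 : ℝ) / Real.sqrt 2) + cubicCoords x 2 * ((slotInt k 2 : ℝ) / Real.sqrt 2)) =
        cubicCoords x 0 * slotInt k 0 + cubicCoords x 1 * slotInt k 1 + cubicCoords x 2 * slotInt k 2 := by
      field_simp
    linarith
  have hm := fccModel_sq_le_one (Real.sqrt 2 * cubicCoords x 0) (Real.sqrt 2 * cubicCoords x 1)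
    (Real.sqrt 2 * cubicCoords x 2) (fun v hv => by
      simp only [fccInt, mem_insert, mem_singleton] at hv
      have k0 := hk 0; have k1 := hk 1; have k2 := hk 2; have k3 := hk 3; have k4 := hk 4; have k5 := hk 5
      have k6 := hk 6; have k7 := hk 7; have k8 := hk 8; have k9 := hk 9; have k10 := hk 10; have k11 := hk 11
      simp only [slotInt, Matrix.cons_val_zero, Matrix.cons_val_one, Matrix.cons_val_two, Matrix.head_cons,
        Matrix.tail_cons, Matrix.cons_val] at k0 k1 k2 k3 k4 k5 k6 k7 k8 k9 k10 k11
      rcases hv with rfl | rfl | rfl | rfl | rfl | rfl | rfl | rfl | rfl | rfl | rfl | rfl <;>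
        simp <;> nlinarith)
  rw [norm_sq_eq_cubicCoords]
  simp only [dotProduct, Fin.sum_univ_three]
  nlinarith

end Summit.Ventures.Crystal3D.Theorems

end
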